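import Mathlib
import HarnessLib

/-!
# PF persistence (pf seat, gen 5) — AMP WIDTH VERSUS POLAR SHIFT: the small-window mechanism, typed

Unit `pub-rhpf-pf-g5` of the `pub-rhpf` cell (long-odds MECHANISM SEARCH; **no RH claims**).
Helper file in support of the cell's target item `EvenSectorBarta.EvenOneSignedWindows`
(stmt-RiemannHypothesis-19953); nothing here is a statement about `ζ`: abstract real inner-product spaces only.

THE SETTING (as in the gen-1…4 PF files).  The even block of the windowed Weil form is `Q = A₀ + β|c⟩⟨c|`
(`A₀` the pole-free operator, `c` the polar vector, `β = 2`); `u` the even bottom state, `Q u = ε u`,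
`p = ⟪c, u⟫`; `φ₀` the bottom state of `A₀`, `A₀ φ₀ = E₀ φ₀`, `c₀ = ⟪c, φ₀⟫`.  The anti-maximum family is
`x(s)`, `A₀ x(s) − s x(s) = −c`, and `u` is a positive multiple of `x(ε)` (`ampVector_of_evenLevel`).

**§1 The variational sandwich (PROVED).**  `E₀ ≤ ε ≤ E₀ + β c₀²`
(`groundLevel_le_evenLevel`, `evenLevel_le_groundLevel_add_polar`): the POLAR SHIFT `ε − E₀` is at most the
polar coupling `β c₀²` of the pole-free bottom state, and exactly `(ε − E₀)·⟪φ₀, u⟫ = β p c₀`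
(`polarShift_mul_overlap`).

**§2 AMP width ⇒ one-signedness (PROVED from the stated hypotheses).**  If the anti-maximum principle for the
polar vector holds on a WIDTH `δ` above `E₀` — every solution of `A₀ w − s w = −c` with `E₀ < s < E₀ + δ` lies
in a cone `Pos` — and the even level sits inside that window (`E₀ < ε < E₀ + δ`), then `u ∈ Pos`
(`pos_of_ampWidth`); by §1 the window condition follows from the TWO-NUMBER test `β c₀² < δ` together with
`E₀ < ε` (`pos_of_polarCoupling_lt_ampWidth`).  Likewise parity: `β c₀² < e − E₀` forces `ε < e` for any
level `e` (`lt_oddLevel_of_polarCoupling_lt`), e.g. the odd bottom level.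

**§3 What the DATA say (engine B, trigonometric Galerkin `N = 80`, `mpmath`; floating multiprecision, UNCERTIFIED;
pub-rhpf-pf/pfprobe/gen5/TABLE-G5-SMALLWIN.md).**  Windows `a = 0.05 … 0.3466 = (log 2)/2` contain no prime
power, so `ζ`'s window form IS the archimedean + polar skeleton there.  Along `a = 0.05, 0.10, …, 0.30, 0.3466`:
(i) the first zero of the AMP family `x(s)` is ALWAYS born at the edge `x = ±a`, at a level `s_c` with
`s_c/ε₁⁻ = 0.99990 → 0.9894` (`ε₁⁻` the odd bottom level, automatically pole-free) — the AMP threshold of the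
polar vector is PINNED to the odd level at every window size (the large-window value is `0.98`,
`PfPersistenceAMPSaturation`), so the width is `δ = s_c − E₀ ≈ ε₁⁻ − E₀`, which happens to be a fixed fraction
`0.714 … 0.728` of the pole-free gap `E₁ − E₀`; (ii) the polar shift obeys `(ε − E₀)/(β c₀²) = 0.996 → 0.948`
(the sandwich of §1 is tight) and `(ε − E₀)/(E₁ − E₀) = 0.11 → 0.69 ≈ 2a`; (iii) hence the two-number test of
§2 holds with margin `0.60 → 0.04` of the gap and the parity test `β c₀² < ε₁⁻ − E₀` with margin
`0.84 → 0.003` of `ε₁⁻ − E₀` — both about to fail at the prime threshold.  At `a = 0.40` the skeleton alone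
(prime `2` deleted) has `ε₁⁻ = −0.0758 < 0 < ε₁⁺ = +0.00063` (parity order LOST, odd sector negative first;
the even value agrees with the cell's Arb-certified `+6.279e-4`, PF.md §15.4) and its even bottom state has a
node at the edge (`min u = −0.076‖u‖` at `x = 0.985a`), while `ζ` itself (prime `2` present) has
`0 < ε₁⁺ = 1.8e-4 < ε₁⁻ = 1.5e-2`, `s_c/ε₁⁻ = 0.987`, and a one-signed bottom state: the long-shift prime
raises the odd level and lowers the even one (tree: `PfPersistenceDownCone`, `PfPersistenceF5OddTailCone`),
which is what keeps `ε` inside the AMP window.  Beyond the prime threshold the test of §2 in its crude form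
`β c₀² < δ` fails also for `ζ` (`β c₀²/(ε₁⁻ − E₀) = 1.03, 1.02, 1.017` at `a = 0.40, 0.45, 0.50`) while the
exact shift still fits (`(ε − E₀)/(s_c − E₀) = 0.990, 0.9986, 0.99990`): from there on one-signedness is the
`1–2 %` affair of the WALL regime (`PfPersistenceAMPOddLevelWall`, `PfPersistenceAMPSaturation`), carried by the
primes.  In the tree, one-signedness at `a ≤ 1/4` is a THEOREM (`oneSignedWindow_of_le_quarter`, eac8e1507069,
via the GroundBarta sign-improving inequality), as is parity order for `a ≤ 0.63`
(`WeilParity.evenSectorWins_upTo_63`).  Nothing in this docstring is used by the theorems below.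

Literature: anti-maximum principles — Clément–Peletier 1979 (doi:10.1016/0022-0396(79)90006-8), Sweers 1997
(doi:10.1006/jdeq.1996.3211), Arora–Glück 2022 (arXiv:2104.12205, Setting 1.1 / Thm 1.2: UNIFORM AMP from a
domination assumption `D(A^m) ⊆ E_u` which the order-`0⁺` pole-free operator does not satisfy — hence a width
for the specific right-hand side `c`, not a uniform one); logarithmic Laplacian bottom state positive and simple —
Chen–Weth 2019, Feulefack–Jarohs–Weth 2022 (arXiv:2010.10448 Prop. 2.?(d)).
-/

set_option linter.dupNamespace false

namespace Summit.RiemannHypothesis.RiemannHypothesis.Theorems.PolarPerronFrobenius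

open scoped InnerProductSpace

variable {E : Type*} [NormedAddCommGroup E] [InnerProductSpace ℝ E]

section sandwich

variable {A₀ : E →ₗ[ℝ] E} {c u φ₀ : E} {β ε E₀ : ℝ}

/-- **The even bottom state is an AMP vector at its own level**: `Q u = ε u` with `Q = A₀ + β|c⟩⟨c|` reads
`A₀ u − ε u = −(β⟪c,u⟫) c`. [folklore] -/
theorem ampVector_of_evenLevel (hu : A₀ u + β • (⟪c, u⟫_ℝ • c) = ε • u) :
    A₀ u - ε • u = -((β * ⟪c, u⟫_ℝ) • c) := by
  rw [mul_smul]
  have : A₀ u = ε • u - β • (⟪c, u⟫_ℝ • c) := by rw [← hu]; abel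
  rw [this]; abel

/-- **Lower half of the sandwich**: if `E₀` is a lower bound of the pole-free form and `β ≥ 0`, the even level
of a unit eigenvector satisfies `E₀ ≤ ε`. [folklore] -/
theorem groundLevel_le_evenLevel (hA0min : ∀ v : E, E₀ * ‖v‖ ^ 2 ≤ ⟪v, A₀ v⟫_ℝ)
    (hu : A₀ u + β • (⟪c, u⟫_ℝ • c) = ε • u) (hun : ‖u‖ = 1) (hβ : 0 ≤ β) : E₀ ≤ ε := by
  have h1 : ⟪u, A₀ u + β • (⟪c, u⟫_ℝ • c)⟫_ℝ = ⟪u, ε • u⟫_ℝ := by rw [hu]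
  rw [inner_add_right, inner_smul_right, inner_smul_right, inner_smul_right,
    real_inner_self_eq_norm_sq, hun, real_inner_comm c u] at h1
  have h2 := hA0min u
  rw [hun] at h2
  nlinarith [sq_nonneg ⟪c, u⟫_ℝ, mul_nonneg hβ (sq_nonneg ⟪c, u⟫_ℝ)]

/-- **Strict lower half**: with `β > 0` and a non-zero polar overlap `⟪c,u⟫ ≠ 0`, `E₀ < ε`. [folklore] -/
theorem groundLevel_lt_evenLevel (hA0min : ∀ v : E, E₀ * ‖v‖ ^ 2 ≤ ⟪v, A₀ v⟫_ℝ)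
    (hu : A₀ u + β • (⟪c, u⟫_ℝ • c) = ε • u) (hun : ‖u‖ = 1) (hβ : 0 < β) (hp : ⟪c, u⟫_ℝ ≠ 0) :
    E₀ < ε := by
  have h1 : ⟪u, A₀ u + β • (⟪c, u⟫_ℝ • c)⟫_ℝ = ⟪u, ε • u⟫_ℝ := by rw [hu]
  rw [inner_add_right, inner_smul_right, inner_smul_right, inner_smul_right,
    real_inner_self_eq_norm_sq, hun, real_inner_comm c u] at h1
  have h2 := hA0min u
  rw [hun] at h2
  have h3 : 0 < ⟪c, u⟫_ℝ * ⟪c, u⟫_ℝ := mul_self_pos.2 hp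
  nlinarith [mul_pos hβ h3]

/-- **Upper half of the sandwich** (Rayleigh quotient of the pole-free bottom state in the full form): if `ε`
is a lower bound of the form `v ↦ ⟪v, A₀ v⟫ + β⟪c, v⟫²` and `φ₀` is a unit eigenvector of `A₀` at `E₀`, then
`ε ≤ E₀ + β ⟪c, φ₀⟫²` — the POLAR SHIFT is at most the polar coupling of `φ₀`. [folklore] -/
theorem evenLevel_le_groundLevel_add_polar
    (hmin : ∀ v : E, ε * ‖v‖ ^ 2 ≤ ⟪v, A₀ v⟫_ℝ + β * ⟪c, v⟫_ℝ ^ 2)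
    (hφ : A₀ φ₀ = E₀ • φ₀) (hφn : ‖φ₀‖ = 1) : ε ≤ E₀ + β * ⟪c, φ₀⟫_ℝ ^ 2 := by
  have h := hmin φ₀
  rw [hφ, inner_smul_right, real_inner_self_eq_norm_sq, hφn] at h
  simpa using h

/-- **The sandwich**: `ε − E₀ ∈ [0, β c₀²]`. [folklore] -/
theorem polarShift_mem_Icc (hA0min : ∀ v : E, E₀ * ‖v‖ ^ 2 ≤ ⟪v, A₀ v⟫_ℝ)
    (hmin : ∀ v : E, ε * ‖v‖ ^ 2 ≤ ⟪v, A₀ v⟫_ℝ + β * ⟪c, v⟫_ℝ ^ 2)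
    (hu : A₀ u + β • (⟪c, u⟫_ℝ • c) = ε • u) (hun : ‖u‖ = 1) (hβ : 0 ≤ β)
    (hφ : A₀ φ₀ = E₀ • φ₀) (hφn : ‖φ₀‖ = 1) :
    ε - E₀ ∈ Set.Icc 0 (β * ⟪c, φ₀⟫_ℝ ^ 2) :=
  ⟨sub_nonneg.2 (groundLevel_le_evenLevel hA0min hu hun hβ),
    by linarith [evenLevel_le_groundLevel_add_polar hmin hφ hφn]⟩

/-- **The polar shift through overlaps (exact)**: pairing the eigen-equation with the pole-free bottom state
(`A₀` symmetric) gives `(ε − E₀)·⟪φ₀, u⟫ = β·⟪c, u⟫·⟪c, φ₀⟫`. [folklore] -/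
theorem polarShift_mul_overlap (hA : ∀ v w : E, ⟪A₀ v, w⟫_ℝ = ⟪v, A₀ w⟫_ℝ)
    (hu : A₀ u + β • (⟪c, u⟫_ℝ • c) = ε • u) (hφ : A₀ φ₀ = E₀ • φ₀) :
    (ε - E₀) * ⟪φ₀, u⟫_ℝ = β * ⟪c, u⟫_ℝ * ⟪c, φ₀⟫_ℝ := by
  have h1 : ⟪φ₀, A₀ u + β • (⟪c, u⟫_ℝ • c)⟫_ℝ = ⟪φ₀, ε • u⟫_ℝ := by rw [hu]
  rw [inner_add_right, inner_smul_right, inner_smul_right, inner_smul_right, ← hA, hφ,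
    inner_smul_left, real_inner_comm c φ₀] at h1
  simp only [conj_trivial] at h1
  linear_combination -h1

/-- **Consequence**: when the two bottom states overlap positively (`⟪φ₀,u⟫ > 0`, e.g. both one-signed) the
polar shift is `β p c₀/⟪φ₀, u⟫`, in particular it has the sign of `β p c₀`. [folklore] -/
theorem polarShift_eq_div (hA : ∀ v w : E, ⟪A₀ v, w⟫_ℝ = ⟪v, A₀ w⟫_ℝ)
    (hu : A₀ u + β • (⟪c, u⟫_ℝ • c) = ε • u) (hφ : A₀ φ₀ = E₀ • φ₀) (hq : ⟪φ₀, u⟫_ℝ ≠ 0) :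
    ε - E₀ = β * ⟪c, u⟫_ℝ * ⟪c, φ₀⟫_ℝ / ⟪φ₀, u⟫_ℝ := by
  rw [eq_div_iff hq]
  exact polarShift_mul_overlap hA hu hφ

end sandwich

section width

variable {A₀ : E →ₗ[ℝ] E} {c u φ₀ : E} {β ε E₀ δ : ℝ} {Pos : E → Prop}

/-- **AMP width ⇒ one-signedness.**  Suppose the anti-maximum principle for the polar vector holds on the
window `(E₀, E₀ + δ)`: every solution of `A₀ w − s w = −c` with `E₀ < s < E₀ + δ` lies in the cone `Pos`
(closed under positive scaling).  If the even level lies in that window and the polar coupling `β⟪c,u⟫` is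
positive, the even bottom state lies in `Pos`. [folklore] -/
theorem pos_of_ampWidth (hcone : ∀ t : ℝ, 0 < t → ∀ w : E, Pos w → Pos (t • w))
    (hamp : ∀ s : ℝ, E₀ < s → s < E₀ + δ → ∀ w : E, A₀ w - s • w = -c → Pos w)
    (hu : A₀ u + β • (⟪c, u⟫_ℝ • c) = ε • u) (hp : 0 < β * ⟪c, u⟫_ℝ)
    (hE : E₀ < ε) (hεδ : ε < E₀ + δ) : Pos u := by
  set m : ℝ := β * ⟪c, u⟫_ℝ with hm
  have hm0 : m ≠ 0 := ne_of_gt hp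
  have hx : A₀ u - ε • u = -(m • c) := ampVector_of_evenLevel hu
  -- the normalised vector w = m⁻¹ • u solves the AMP equation at level ε
  have hw : A₀ (m⁻¹ • u) - ε • (m⁻¹ • u) = -c := by
    rw [LinearMap.map_smul, smul_comm ε m⁻¹ u, ← smul_sub, hx, smul_neg, smul_smul,
      inv_mul_cancel₀ hm0, one_smul]
  have hwpos : Pos (m⁻¹ • u) := hamp ε hE hεδ _ hw
  have := hcone m hp _ hwpos
  rwa [smul_smul, mul_inv_cancel₀ hm0, one_smul] at this

/-- **The two-number test.**  AMP width `δ` for the polar vector, polar coupling of the pole-free bottom state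
`β c₀² < δ`, the variational characterisation of `ε`, and `E₀ < ε` (e.g. `groundLevel_lt_evenLevel`) force the
even bottom state into the cone.  (DATA: `β c₀² ≈ 2a·gap < δ_c ≈ 0.72·gap` for `a ≤ 0.3466`.) [folklore] -/
theorem pos_of_polarCoupling_lt_ampWidth (hcone : ∀ t : ℝ, 0 < t → ∀ w : E, Pos w → Pos (t • w))
    (hamp : ∀ s : ℝ, E₀ < s → s < E₀ + δ → ∀ w : E, A₀ w - s • w = -c → Pos w)
    (hmin : ∀ v : E, ε * ‖v‖ ^ 2 ≤ ⟪v, A₀ v⟫_ℝ + β * ⟪c, v⟫_ℝ ^ 2)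
    (hφ : A₀ φ₀ = E₀ • φ₀) (hφn : ‖φ₀‖ = 1)
    (hu : A₀ u + β • (⟪c, u⟫_ℝ • c) = ε • u) (hp : 0 < β * ⟪c, u⟫_ℝ) (hE : E₀ < ε)
    (hshift : β * ⟪c, φ₀⟫_ℝ ^ 2 < δ) : Pos u :=
  pos_of_ampWidth hcone hamp hu hp hE
    (lt_of_le_of_lt (evenLevel_le_groundLevel_add_polar hmin hφ hφn) (by linarith))

/-- **The same test, fully from form bounds** (`β > 0`, `⟪c,u⟫ > 0`, `E₀` the bottom of the pole-free form):
no level is assumed to lie anywhere. [folklore] -/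
theorem pos_of_polarCoupling_lt_ampWidth' (hcone : ∀ t : ℝ, 0 < t → ∀ w : E, Pos w → Pos (t • w))
    (hamp : ∀ s : ℝ, E₀ < s → s < E₀ + δ → ∀ w : E, A₀ w - s • w = -c → Pos w)
    (hA0min : ∀ v : E, E₀ * ‖v‖ ^ 2 ≤ ⟪v, A₀ v⟫_ℝ)
    (hmin : ∀ v : E, ε * ‖v‖ ^ 2 ≤ ⟪v, A₀ v⟫_ℝ + β * ⟪c, v⟫_ℝ ^ 2)
    (hφ : A₀ φ₀ = E₀ • φ₀) (hφn : ‖φ₀‖ = 1)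
    (hu : A₀ u + β • (⟪c, u⟫_ℝ • c) = ε • u) (hun : ‖u‖ = 1) (hβ : 0 < β) (hp : 0 < ⟪c, u⟫_ℝ)
    (hshift : β * ⟪c, φ₀⟫_ℝ ^ 2 < δ) : Pos u :=
  pos_of_polarCoupling_lt_ampWidth hcone hamp hmin hφ hφn hu (mul_pos hβ hp)
    (groundLevel_lt_evenLevel hA0min hu hun hβ (ne_of_gt hp)) hshift

/-- **Parity from the polar coupling.**  If the polar coupling of the pole-free bottom state is smaller than the
distance from `E₀` to a level `e` (e.g. the odd bottom level, untouched by the even polar vector), then the even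
level lies below `e`. (DATA: `β c₀²/(ε₁⁻ − E₀) = 0.156 → 0.997` over `a = 0.05 → 0.3466`.) [folklore] -/
theorem lt_oddLevel_of_polarCoupling_lt {e : ℝ}
    (hmin : ∀ v : E, ε * ‖v‖ ^ 2 ≤ ⟪v, A₀ v⟫_ℝ + β * ⟪c, v⟫_ℝ ^ 2)
    (hφ : A₀ φ₀ = E₀ • φ₀) (hφn : ‖φ₀‖ = 1) (hgap : β * ⟪c, φ₀⟫_ℝ ^ 2 < e - E₀) : ε < e := by
  have := evenLevel_le_groundLevel_add_polar hmin hφ hφn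
  linarith

/-- **Contrapositive bookkeeping**: if the even level is NOT below `e` then the polar coupling of the pole-free
bottom state is at least `e − E₀` — parity failure needs a polar coupling as large as the pole-free parity gap.
[folklore] -/
theorem polarCoupling_ge_of_not_lt {e : ℝ}
    (hmin : ∀ v : E, ε * ‖v‖ ^ 2 ≤ ⟪v, A₀ v⟫_ℝ + β * ⟪c, v⟫_ℝ ^ 2)
    (hφ : A₀ φ₀ = E₀ • φ₀) (hφn : ‖φ₀‖ = 1) (h : e ≤ ε) : e - E₀ ≤ β * ⟪c, φ₀⟫_ℝ ^ 2 := by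
  have := evenLevel_le_groundLevel_add_polar hmin hφ hφn
  linarith

/-- **AMP failure forces a large polar shift**: if the even bottom state is NOT in the cone although the AMP
holds on the width `δ` and `E₀ < ε`, then `ε ≥ E₀ + δ` — the polar shift has left the AMP window. [folklore] -/
theorem groundLevel_add_width_le_of_not_pos (hcone : ∀ t : ℝ, 0 < t → ∀ w : E, Pos w → Pos (t • w))
    (hamp : ∀ s : ℝ, E₀ < s → s < E₀ + δ → ∀ w : E, A₀ w - s • w = -c → Pos w)
    (hu : A₀ u + β • (⟪c, u⟫_ℝ • c) = ε • u) (hp : 0 < β * ⟪c, u⟫_ℝ) (hE : E₀ < ε)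
    (hnot : ¬ Pos u) : E₀ + δ ≤ ε := by
  by_contra h
  exact hnot (pos_of_ampWidth hcone hamp hu hp hE (not_le.mp h))

end width

end Summit.RiemannHypothesis.RiemannHypothesis.Theorems.PolarPerronFrobenius
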